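import Literature.AlgebraicGeometry.Resolution.VertexBlowupProjectionMorphism
import Literature.AlgebraicGeometry.Resolution.VertexProjectionRingHomSmooth
import Literature.AlgebraicGeometry.Resolution.PointBlowupSectionRingHom
import HarnessLib

/-!
# The blow-up of `ℙ^{d+1}` in the vertex: `q : P̃ → ℙ^d` is smooth, and the exceptional divisor is a section

Topic: `Literature/AlgebraicGeometry/Resolution`. Fourth scheme-level step of the construction of
de Jong 1996, proof of Lemma 4.11 (p. 68), for ANY blowing up `b : P̃ → ℙ^{d+1}_k` of projective
space in the vertex `p` and its projection `q : P̃ → ℙ^d`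
(`VertexBlowupProjectionMorphism.lean`). PROVED here:

* `DeJong1996.smooth_vertexProjection` — the linear projection from the vertex
  `ℙ^{d+1} ∖ {p} → ℙ^d` (`vertexProjection`, `AlterationsLemma411VertexProjection.lean`) is
  smooth: on the charts `D₊(xᵢ)`, `i ≤ d`, it is `Spec` of a polynomial algebra in one variable
  (`smooth_vertexProjectionRingHom`);
* `DeJong1996.smooth_vertexBlowupProjection` — **`q : P̃ → ℙ^d` is smooth** ("`q = pr_p` is
  smooth (a `ℙ¹`-bundle)", the field `smooth` of `DeJong1996.PointBlowupProjection`): off the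
  exceptional divisor `q` is the smooth `pr_p` composed with the isomorphism
  `b| : P̃ ∖ E ≅ ℙ^{d+1} ∖ {p}` (Stacks 02OS, `IsBlowup.isIso_morphismRestrict`), and on the charts
  `Spec k[X][I/Xᵢ]` over `D₊(x_{d+1})` it is `Spec` of the smooth `y_a/yᵢ ↦ X_a/Xᵢ`
  (`PointBlowup.smooth_projRingHom`); smoothness is local on the source;
* `DeJong1996.vertexChartSection hb i : D₊(yᵢ) → P̃` — **the exceptional divisor as a section of
  `q` over the chart `D₊(yᵢ)`**: `Spec` of the retraction `k[X][I/Xᵢ] → k[Y] ≅ (k[y]_{(yᵢ)})₀`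
  (`PointBlowup.sectRingHom`) followed by the chart; `vertexChartSection_comp_projection`:
  `s ≫ q = D₊(yᵢ) ↪ ℙ^d`, and `apply_vertexChartSection`: `b ∘ s` is the vertex — so
  **every fibre of `q` meets `E = b⁻¹(p)`** (`DeJong1996.exists_apply_eq_vertex`, the field
  `exists_apply_eq` of `PointBlowupProjection`: "`E ≅ ℙ^d` is a section of `q`").

No named facts; definitions: the chart sections only.

## Sources

* A. J. de Jong, *Smoothness, semi-stability and alterations*, Publ. Math. IHÉS 83 (1996),
  proof of Lemma 4.11, p. 68. [DeJong1996]
* D. Eisenbud, J. Harris, *3264 and All That* (2016), §9.3.2 and Prop. 9.11 (the blow-up of `ℙⁿ`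
  in a point is a `ℙ¹`-bundle over `ℙ^{n-1}`, the exceptional divisor a section). [EisenbudHarris2016]
* The Stacks Project, Tag 02OS (a blowing up is an isomorphism off the centre). [StacksProject]
-/

noncomputable section

open CategoryTheory CategoryTheory.Limits AlgebraicGeometry TopologicalSpace HomogeneousLocalization

attribute [local instance] MvPolynomial.gradedAlgebra
  Literature.AlgebraicGeometry.Motives.ProjBaseChange.algebraBase
  Literature.AlgebraicGeometry.Motives.ProjBaseChange.isScalarTower_localization

namespace Literature.AlgebraicGeometry.Resolution

universe u

open Literature.AlgebraicGeometry.Motives (projectiveSpace GeneratingSections)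
open Literature.AlgebraicGeometry.Motives.Segre (grading chartι toSpec X_mem frac cst)
open Literature.AlgebraicGeometry.Motives.RatFn

namespace DeJong1996

variable (d : ℕ) (k : Type u) [Field k]

/-! ## The linear projection from the vertex is smooth -/

/-- The chart `Spec (k[x]_{(xᵢ)})₀ → ℙ^{d+1} ∖ {vertex}`, `i ≤ d`, is an open immersion. [folklore] -/
instance isOpenImmersion_chartToPunctured (i : Fin (d + 1)) : IsOpenImmersion (chartToPunctured d k i) := by
  haveI : IsOpenImmersion (chartToPunctured d k i ≫ (puncturedSpace d k).ι) := by
    rw [chartToPunctured_ι]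
    infer_instance
  exact IsOpenImmersion.of_comp _ (puncturedSpace d k).ι

/-- The charts `Spec (k[x]_{(xᵢ)})₀`, `i ≤ d`, cover the punctured space. [folklore] -/
theorem exists_chartToPunctured_apply_eq (x : (puncturedSpace d k : Scheme.{u})) :
    ∃ (i : Fin (d + 1)) (y : Spec (.of (Away (grading (Fin (d + 1 + 1)) k) (MvPolynomial.X (Fin.castSucc i))))),
      chartToPunctured d k i y = x := by
  have hx : x.1 ∈ ⨆ i : Fin (d + 1),
      Proj.basicOpen (grading (Fin (d + 1 + 1)) k) (MvPolynomial.X (Fin.castSucc i)) := x.2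
  obtain ⟨i, hi⟩ := Opens.mem_iSup.mp hx
  rw [← Proj.opensRange_awayι _ _ (X_mem k (Fin.castSucc i)) zero_lt_one] at hi
  obtain ⟨y, hy⟩ := hi
  refine ⟨i, y, ?_⟩
  apply (puncturedSpace d k).ι.isOpenEmbedding.injective
  rw [← Scheme.Hom.comp_apply, chartToPunctured_ι]
  exact hy

/-- The open cover of `ℙ^{d+1} ∖ {vertex}` by the charts `Spec (k[x]_{(xᵢ)})₀`, `i ≤ d`.
[folklore] -/
def puncturedChartCover : (puncturedSpace d k : Scheme.{u}).OpenCover :=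
  Scheme.Cover.mkOfCovers (Fin (d + 1)) _ (chartToPunctured d k) (fun x => exists_chartToPunctured_apply_eq d k x)

/-- **The linear projection from the vertex `ℙ^{d+1} ∖ {p} → ℙ^d` is smooth** (on `D₊(xᵢ)` it is
`Spec` of the smooth ring map `y_a/yᵢ ↦ x_a/xᵢ`, `smooth_vertexProjectionRingHom`, followed by
the open immersion `D₊(yᵢ) ↪ ℙ^d`). [cite: DeJong1996, Lemma 4.11 (proof), p. 68] -/
theorem smooth_vertexProjection : Smooth (vertexProjection d k) := by
  refine IsZariskiLocalAtSource.of_openCover (P := @Smooth) (puncturedChartCover d k) fun i => ?_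
  change Smooth (chartToPunctured d k i ≫ vertexProjection d k)
  rw [chartToPunctured_comp_vertexProjection, vertexProjectionChart]
  haveI : Smooth (Spec.map (CommRingCat.ofHom (vertexProjectionRingHom d k i))) :=
    (HasRingHomProperty.Spec_iff (P := @Smooth)).mpr (smooth_vertexProjectionRingHom d k i)
  infer_instance

/-! ## `q` is smooth -/

section Smooth

variable {d k}
variable {P : Scheme.{u}} {b : P ⟶ Proj (grading (Fin (d + 1 + 1)) k)}

/-- The complement of the centre of the blowing up is the punctured space. [folklore] -/
theorem centreCompl_vertexIdealSheaf_eq :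
    (⟨((vertexIdealSheaf d k).support : Set (Proj (grading (Fin (d + 1 + 1)) k)))ᶜ,
      (vertexIdealSheaf d k).support.isClosed.isOpen_compl⟩ : (Proj (grading (Fin (d + 1 + 1)) k)).Opens) =
      puncturedSpace d k := by
  ext x
  change x ∉ ((vertexIdealSheaf d k).support : Set _) ↔ x ∈ (puncturedSpace d k : Set _)
  rw [vertexIdealSheaf, Scheme.IdealSheafData.coe_support_vanishingIdeal]
  change x ∉ ({vertex d k} : Set _) ↔ x ∈ puncturedSpace d k
  rw [Set.mem_singleton_iff, mem_puncturedSpace_iff]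

/-- **`b` is an isomorphism over `ℙ^{d+1} ∖ {vertex}`** (Stacks 02OS). [cite: StacksProject, Tag 02OS] -/
theorem isIso_morphismRestrict_puncturedSpace (hb : IsBlowup b (vertexIdealSheaf d k)) :
    IsIso (b ∣_ puncturedSpace d k) := by
  have h := hb.isIso_compl
  rwa [centreCompl_vertexIdealSheaf_eq] at h

variable (b) [IsIntegral P] [IsDominant b] (hb : IsBlowup b (vertexIdealSheaf d k))

/-- Off the exceptional divisor, `q` is the smooth `pr_p ∘ b|`. [folklore] -/
theorem smooth_preimage_ι_comp_vertexBlowupProjection :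
    Smooth ((b ⁻¹ᵁ puncturedSpace d k).ι ≫ vertexBlowupProjection b hb) := by
  rw [(isVertexProjection_vertexBlowupProjection b hb).preimage_ι_comp d k]
  haveI := isIso_morphismRestrict_puncturedSpace hb
  haveI := smooth_vertexProjection d k
  infer_instance

/-- On the charts `Spec k[X][I/Xᵢ]`, `q` is `Spec` of the smooth `y_a/yᵢ ↦ X_a/Xᵢ`. [folklore] -/
theorem smooth_vertexChart_comp_vertexBlowupProjection (i : Fin (d + 1)) :
    Smooth (vertexChart hb i ≫ vertexBlowupProjection b hb) := by
  rw [vertexChart_comp_vertexBlowupProjection]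
  haveI : Smooth (Spec.map (CommRingCat.ofHom (PointBlowup.projRingHom d k i))) :=
    (HasRingHomProperty.Spec_iff (P := @Smooth)).mpr (PointBlowup.smooth_projRingHom d k i)
  infer_instance

/-- The open cover of `P̃` by `b⁻¹(ℙ^{d+1} ∖ {vertex})` and the charts `Spec k[X][I/Xᵢ]`. [folklore] -/
def blowupCover : P.OpenCover :=
  Scheme.Cover.mkOfCovers (Option (Fin (d + 1)))
    (fun o => o.elim (b ⁻¹ᵁ puncturedSpace d k : Scheme.{u}) fun i => Spec (.of (PointBlowup.Chart d k i)))
    (fun o => match o with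
      | none => (b ⁻¹ᵁ puncturedSpace d k).ι
      | some i => vertexChart hb i)
    (fun x => by
      rcases mem_preimage_basicOpen_or_mem_opensRange hb x with ⟨j, hj⟩ | ⟨i, y, hy⟩
      · refine ⟨none, ⟨x, ?_⟩, rfl⟩
        change b x ∈ puncturedSpace d k
        exact basicOpen_le_puncturedSpace d k j hj
      · exact ⟨some i, y, hy⟩)
    (fun o => by
      cases o with
      | none => exact inferInstanceAs (IsOpenImmersion (b ⁻¹ᵁ puncturedSpace d k).ι)
      | some i => exact inferInstanceAs (IsOpenImmersion (vertexChart hb i)))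

/-- **`q : P̃ → ℙ^d` is smooth** for every blowing up `b : P̃ → ℙ^{d+1}` of the vertex
("`q = pr_p` is smooth (a `ℙ¹`-bundle)"). [cite: DeJong1996, Lemma 4.11 (proof), p. 68] -/
theorem smooth_vertexBlowupProjection : Smooth (vertexBlowupProjection b hb) := by
  refine IsZariskiLocalAtSource.of_openCover (P := @Smooth) (blowupCover b hb) fun o => ?_
  cases o with
  | none => exact smooth_preimage_ι_comp_vertexBlowupProjection b hb
  | some i => exact smooth_vertexChart_comp_vertexBlowupProjection b hb i

end Smooth

/-! ## The exceptional divisor as a section of `q` over the charts `D₊(yᵢ)` -/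

section Section

variable {d k}

/-- The ring map `k[X][I/Xᵢ] → k[Y_a : a ≠ i] ≅ (k[y]_{(yᵢ)})₀` of the section: kill `Xᵢ`, then
homogenise. [cite: EisenbudHarris2016, §9.3.2] -/
def sectToAway (d : ℕ) (k : Type u) [Field k] (i : Fin (d + 1)) :
    PointBlowup.Chart d k i →+* Away (grading (Fin (d + 1)) k) (MvPolynomial.X i) :=
  (PointBlowup.awayBaseEquiv d k i).symm.toRingHom.comp (PointBlowup.sectRingHom d k i)

/-- `sectToAway ∘ projRingHom = id`: the section is a section of the projection on the chart.
[folklore] -/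
theorem sectToAway_comp_projRingHom (i : Fin (d + 1)) :
    (sectToAway d k i).comp (PointBlowup.projRingHom d k i) =
      RingHom.id (Away (grading (Fin (d + 1)) k) (MvPolynomial.X i)) := by
  refine RingHom.ext fun a => ?_
  rw [RingHom.comp_apply, PointBlowup.projRingHom, RingHom.comp_apply, sectToAway, RingHom.comp_apply,
    AlgHom.toRingHom_eq_coe, RingHom.coe_coe, PointBlowup.sectRingHom_baseHom]
  simp

/-- `sectToAway (Xᵢ) = 0` and `sectToAway (X_j) = 0`: the section lies in the exceptional
divisor, over the origin. [folklore] -/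
theorem sectToAway_algebraMap_X (i j : Fin (d + 1)) :
    sectToAway d k i (algebraMap (MvPolynomial (Fin (d + 1)) k) (PointBlowup.Chart d k i)
      (MvPolynomial.X j)) = 0 := by
  rw [sectToAway, RingHom.comp_apply, PointBlowup.sectRingHom_algebraMap_X, map_zero]

/-- `sectToAway` kills the coordinate sections `xⱼ/x_{d+1}` read on the chart. [folklore] -/
theorem sectToAway_toChart_vertexSection (i j : Fin (d + 1)) :
    sectToAway d k i (toChart d k i (vertexSection d k j)) = 0 := by
  rw [toChart_vertexSection, map_mul]
  change sectToAway d k i (algebraMap (MvPolynomial (Fin (d + 1)) k) (PointBlowup.Chart d k i)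
    (MvPolynomial.X i)) * _ = 0
  rw [sectToAway_algebraMap_X, zero_mul]

variable {P : Scheme.{u}} {b : P ⟶ Proj (grading (Fin (d + 1 + 1)) k)}

/-- **The section of `q` over `D₊(yᵢ)` through the exceptional divisor**: `Spec` of `sectToAway`
followed by the chart `Spec k[X][I/Xᵢ] → P̃`. [cite: EisenbudHarris2016, §9.3.2] -/
def vertexChartSection (hb : IsBlowup b (vertexIdealSheaf d k)) (i : Fin (d + 1)) :
    Spec (.of (Away (grading (Fin (d + 1)) k) (MvPolynomial.X i))) ⟶ P :=
  Spec.map (CommRingCat.ofHom (sectToAway d k i)) ≫ vertexChart hb i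

/-- **`s ≫ q` is the chart inclusion `D₊(yᵢ) ↪ ℙ^d`.** [folklore] -/
theorem vertexChartSection_comp_projection [IsIntegral P] [IsDominant b]
    (hb : IsBlowup b (vertexIdealSheaf d k)) (i : Fin (d + 1)) :
    vertexChartSection hb i ≫ vertexBlowupProjection b hb = chartι k i := by
  rw [vertexChartSection, Category.assoc, vertexChart_comp_vertexBlowupProjection, ← Spec.map_comp_assoc,
    ← CommRingCat.ofHom_comp, sectToAway_comp_projRingHom, CommRingCat.ofHom_id, Spec.map_id,
    Category.id_comp]

/-- **`b ∘ s` is the vertex**: the section lies in the exceptional divisor `E = b⁻¹(p)`.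
[cite: DeJong1996, Lemma 4.11 (proof), p. 68] -/
theorem apply_vertexChartSection (hb : IsBlowup b (vertexIdealSheaf d k)) (i : Fin (d + 1))
    (p : Spec (.of (Away (grading (Fin (d + 1)) k) (MvPolynomial.X i)))) :
    b (vertexChartSection hb i p) = vertex d k := by
  -- the point of `Spec Γ(D₊(x_{d+1}))` under `s p`
  let r := Spec.map (CommRingCat.ofHom ((sectToAway d k i).comp (toChart d k i))) p
  have hbs : b (vertexChartSection hb i p) = (lastChart d k).2.fromSpec r := by
    rw [vertexChartSection, ← Scheme.Hom.comp_apply, Category.assoc, vertexChart_comp hb i,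
      ← Spec.map_comp_assoc, ← CommRingCat.ofHom_comp, Scheme.Hom.comp_apply]
  -- its prime contains the ideal of the vertex
  have hle : (vertexIdealSheaf d k).ideal (lastChart d k) ≤ r.asIdeal := by
    rw [← span_range_vertexSection, Ideal.span_le]
    rintro _ ⟨j, rfl⟩
    change vertexSection d k j ∈ (PrimeSpectrum.comap ((sectToAway d k i).comp (toChart d k i)) p).asIdeal
    rw [PrimeSpectrum.comap_asIdeal, Ideal.mem_comap, RingHom.comp_apply, sectToAway_toChart_vertexSection]
    exact Ideal.zero_mem _
  -- hence `b (s p)` lies in the support `{vertex}`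
  have hmem : (lastChart d k).2.fromSpec r ∈ ((vertexIdealSheaf d k).support : Set _) := by
    have hz : (lastChart d k).2.fromSpec r ∈
        (Proj (grading (Fin (d + 1 + 1)) k)).zeroLocus (U := lastChart d k)
          ((vertexIdealSheaf d k).ideal (lastChart d k)) ∩ (lastChart d k : (Proj (grading (Fin (d + 1 + 1)) k)).Opens) := by
      rw [← (lastChart d k).2.fromSpec_image_zeroLocus]
      exact ⟨r, (PrimeSpectrum.mem_zeroLocus _ _).mpr hle, rfl⟩
    exact (Scheme.IdealSheafData.mem_support_iff_of_mem (I := vertexIdealSheaf d k) (U := lastChart d k)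
      hz.2).mpr hz.1
  rw [hbs]
  rw [vertexIdealSheaf, Scheme.IdealSheafData.coe_support_vanishingIdeal] at hmem
  exact hmem

/-- **Every fibre of `q` meets the exceptional divisor `E = b⁻¹(vertex)`** (`E ≅ ℙ^d` is a
section of `q`): for every `y ∈ ℙ^d` there is `e ∈ P̃` with `b e = vertex` and `q e = y`.
[cite: DeJong1996, Lemma 4.11 (proof), p. 68] -/
theorem exists_apply_eq_vertex [IsIntegral P] [IsDominant b] (hb : IsBlowup b (vertexIdealSheaf d k))
    (y : Proj (grading (Fin (d + 1)) k)) :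
    ∃ e : P, b e = vertex d k ∧ vertexBlowupProjection b hb e = y := by
  obtain ⟨i, hi⟩ := (GeneratingSections.ofHom (𝟙 (Proj (grading (Fin (d + 1)) k)))).exists_mem_U y
  change y ∈ Proj.basicOpen (grading (Fin (d + 1)) k) (MvPolynomial.X i) at hi
  rw [← Proj.opensRange_awayι _ _ (X_mem k i) zero_lt_one] at hi
  obtain ⟨p, rfl⟩ := hi
  refine ⟨vertexChartSection hb i p, apply_vertexChartSection hb i p, ?_⟩
  rw [← Scheme.Hom.comp_apply, vertexChartSection_comp_projection]

end Section

end DeJong1996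

end Literature.AlgebraicGeometry.Resolution

end
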